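import Summits.AtomisticToContinuum.Crystallization.Theorems.ChartedZeroExcessLayeredLatticeLiouvilleZZZYRCZW
import Summits.AtomisticToContinuum.Crystallization.Theorems.ChartedZeroExcessLayeredLatticeLiouvilleZZZYRCZX

/-!
# Charted zero-excess layered-lattice Liouville — ZZZYRCZY: the THREE-WAY BOX READER for LETTER-FUNCTION boxes (R3-W), with OFFSET TABLES

Cell `decomp-a2c`, lens 2 («special vs generic»), generation 100.  Line (D) TAIL-DEBIT of `UniformEquilStabilityAt`; door
`uniformEquilStabilityAt_of_atlasW` (ZZZYRCZT), near reader `thetaReaderNearF_holds` (ZZZYRCZW).  This file is ZZZYRCY for letter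
sequences — what a shape cell `InBoxW` needs to discharge its `BoxTailDebitP` through `boxTailDebitP_of_scheme` (ZZZYRCH):

§1 ★ UNIFORM (WORD-INDEPENDENT) NEAR TABLES.  If ONE integer table pair `(TRX, TNX)` majorises the kernel tables of EVERY ADMITTED window
   type (`KernelSlabSoundF H₀ R ω … (cdOf ω) TRX TNX` for all `ω` of length `2H₀+1` with letters in `{0,1,2}` and `Adm ω` — of record
   `Adm := IsHollowWindow (2H₀+1)`, the `3·2^{2H₀}` HOLLOW types, decided certificates), then for EVERY letter sequence `ℓ` whose windows are
   admitted (`isHollowWindow_windowWord`) the windowed reader holds with the data `cdOf (windowWord ℓ (m − H₀) (2H₀+1))` and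
   the layer-sum majorants collapse to the OFFSET TABLES `offsetSumF H₀ R T (y.2 − y.1) = Σ_{d ∈ [H₀−R, H₀+R]} T (d, Δγ₀, Δγ₁, Δm)`
   (`thetaSumR_const`, `thetaSumN_const`; `thetaReaderNearF_of_types`): a function of the piece OFFSET only, hence the same currency as the
   periodic tables for the cluster certificate — and LITERALLY census's LOOKUP-SUM `Σ_d max_ω TR(ω)(d,·)` once `TRX := max_ω TR(ω)`.
§2 the splice at the ideal cut of a letter sequence (`idealSpliceNF / idealSpliceZF`) and the NEAR ∪ MIDDLE cover lemmas (ZZZYRCY §3 ported).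
§3 ★ the registry floor lemma and the MIDDLE PLACEMENT for letter sequences (`xiFloor_le_n9F`, `middle_hgeoF`: the `hgeo` of
   `schemeDominatedOnP_middle`, ZZZYRCVP, at `P := ¬ IdealNearF ℓ hi ∧ ‖e‖ ≤ D`) — ZZZYRCY §1–§2 ported letter for letter.
§4 ★★ THE THREE-WAY BOX READER `boxSchemeP_of_cover3F`: as ZZZYRCY's, with the cut `IdealNearF (ℓf L w') hi` along a LETTER ASSIGNMENT
   `ℓf` of the box (near system and near/middle tables are functions of the word through `ℓf`); §5 the canonical assignments `letterOfW` of a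
   shape cell and `letterOfWH` of a hollow shape cell (ZZZYRCZX) (`…_spec`: letters (hollow) and `SlabBoxF` for every word of the cell), which
   feed ZZZYRCZO/ZZZYRCZP's comparisons and §1.

What remains OPEN on line (D) after this file is unchanged and named in ZZZYRCZT/ZZZYRCZX: (RI♯-C) = registered re-indexing + `HBandP` +
`HollowP`, (ABAND), the per-type kernel certificates (hand-1), the Ξ / θ⁰ slab K-files and the cell / cluster certificates per shape cell.
Theorem file (6 defs, 17 theorems); imports ZZZYRCZW, ZZZYRCZX; no instance / notation / option; 0 sorry. [g100]
-/

namespace Summit.AtomisticToContinuum.Crystallization.Theorems.ChartedZeroExcessLayeredLatticeLiouville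

open scoped BigOperators RealInnerProductSpace
open Summit.AtomisticToContinuum.Crystallization.Theorems.ChartedPlanarOrderRigidityDoor (E3)

/-! ### §1 uniform tables over all window types and the offset tables -/

/-- ★ the OFFSET TABLE of a common key table `T`: `Σ_{d ∈ [H₀−R, H₀+R]} T (d, δγ₀, δγ₁, δm)` — a function of the piece offset `δ` only. [g100] -/
noncomputable def offsetSumF (H₀ R : ℕ) (T : ℤ × ℤ × ℤ × ℤ → ℝ) (δ : Cell 2 × ℤ) : ℝ :=
  ∑ d ∈ Finset.Icc ((H₀ : ℤ) - R) (H₀ + R), T (d, δ.1 0, δ.1 1, δ.2)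

/-- the layer sum of a layer-independent table is the offset table (re-index `m ↦ y.1.2 − m + H₀`). [g100] -/
theorem sum_keyAtF_const (H₀ R : ℕ) (T : ℤ × ℤ × ℤ × ℤ → ℝ) (y : (Cell 2 × ℤ) × (Cell 2 × ℤ)) :
    ∑ m ∈ Finset.Icc (y.1.2 - R) (y.1.2 + R), T (keyAtF H₀ m y) = offsetSumF H₀ R T (y.2 - y.1) := by
  unfold offsetSumF
  refine Finset.sum_nbij' (fun m => y.1.2 - m + H₀) (fun d => y.1.2 - d + H₀) (fun m hm => ?_) (fun d hd => ?_) (fun m _ => by ring)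
    (fun d _ => by ring) (fun m _ => rfl)
  · rw [Finset.mem_Icc] at hm ⊢; omega
  · rw [Finset.mem_Icc] at hd ⊢; omega

/-- `thetaSumR` of a layer-independent table is `(1+α)λ⁻⁸ ×` its offset table. [g100] -/
theorem thetaSumR_const (H₀ R : ℕ) (α lam : ℝ) (T : ℤ × ℤ × ℤ × ℤ → ℝ) (y : (Cell 2 × ℤ) × (Cell 2 × ℤ)) :
    thetaSumR H₀ R α lam (fun _ => T) y = (1 + α) * (lam ^ 8)⁻¹ * offsetSumF H₀ R T (y.2 - y.1) := by
  rw [thetaSumR, sum_keyAtF_const]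

/-- `thetaSumN` of layer-independent tables is `(1+α⁻¹)λ⁻⁸ ×` the offset table of `K·TN + η·TR`. [g100] -/
theorem thetaSumN_const (H₀ R : ℕ) (α lam K η : ℝ) (TR TN : ℤ × ℤ × ℤ × ℤ → ℝ) (y : (Cell 2 × ℤ) × (Cell 2 × ℤ)) :
    thetaSumN H₀ R α lam K η (fun _ => TR) (fun _ => TN) y =
      (1 + α⁻¹) * (lam ^ 8)⁻¹ * offsetSumF H₀ R (fun k => K * TN k + η * TR k) (y.2 - y.1) := by
  rw [thetaSumN, ← sum_keyAtF_const]

/-- kernel soundness is monotone in the tables: a common table pair majorising every type's tables (e.g. the key-wise maximum over the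
admitted types — census's LOOKUP-SUM `max_ω`) is sound for every type. [g100] -/
theorem kernelSlabSoundF_mono {H₀ R : ℕ} {wd : List ℤ} {lo hi P9max : ℤ} {E : ℕ} {cd : List ChordDatum} {TR TN TR' TN' : ℤ × ℤ × ℤ × ℤ → ℤ}
    (hR : ∀ k, TR k ≤ TR' k) (hN : ∀ k, TN k ≤ TN' k) (h : KernelSlabSoundF H₀ R wd lo hi P9max E cd TR TN) :
    KernelSlabSoundF H₀ R wd lo hi P9max E cd TR' TN' := by
  intro ℓ hℓ hag
  obtain ⟨hV, hT⟩ := h ℓ hℓ hag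
  refine ⟨hV, fun k => ⟨(hT k).1.trans ?_, (hT k).2.trans ?_⟩⟩
  · exact div_le_div_of_nonneg_right (by exact_mod_cast hR k) (by positivity)
  · exact div_le_div_of_nonneg_right (by exact_mod_cast hN k) (by positivity)

/-- a window word of length `N` is HOLLOW: consecutive letters distinct (the admitted types of record). [g100] -/
def IsHollowWindow (N : ℕ) (ω : List ℤ) : Prop := ∀ j : ℤ, 0 ≤ j → j + 1 < (N : ℤ) → regW ω (j + 1) ≠ regW ω j

/-- the windows of a hollow letter sequence are hollow. [g100] -/
theorem isHollowWindow_windowWord {ℓ : ℤ → ℤ} (h : IsHollowSeq ℓ) (m₀ : ℤ) (N : ℕ) : IsHollowWindow N (windowWord ℓ m₀ N) := by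
  intro j h0 hj heq
  rw [regW_windowWord ℓ m₀ (by omega) hj, regW_windowWord ℓ m₀ h0 (by omega), ← add_assoc] at heq
  exact h (m₀ + j) heq

/-- ★ window data from ONE table pair sound for EVERY ADMITTED window type, for a sequence whose windows are admitted. [g100] -/
theorem windowDataF_of_types {H₀ R : ℕ} {ℓ : ℤ → ℤ} {lo hi P9max : ℤ} {E : ℕ} {cdOf : List ℤ → List ChordDatum}
    {TRX TNX : ℤ × ℤ × ℤ × ℤ → ℤ} {Adm : List ℤ → Prop} (hℓ : IsLetterSeq ℓ) (hwin : ∀ m : ℤ, Adm (windowWord ℓ (m - H₀) (2 * H₀ + 1)))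
    (hT : ∀ ω : List ℤ, ω.length = 2 * H₀ + 1 → IsLetterSeq (regW ω) → Adm ω → KernelSlabSoundF H₀ R ω lo hi P9max E (cdOf ω) TRX TNX) :
    WindowDataF H₀ R ℓ lo hi P9max (fun m => cdOf (windowWord ℓ (m - H₀) (2 * H₀ + 1))) (fun _ k => (TRX k : ℝ) / 2 ^ E)
      fun _ k => (TNX k : ℝ) / 2 ^ E :=
  windowDataF_of_kernel hℓ fun m =>
    hT _ (windowWord_length ℓ (m - H₀) (2 * H₀ + 1)) (isLetterSeq_regW_windowWord hℓ (m - H₀) (2 * H₀ + 1)) (hwin m)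

/-- ★★ THE WINDOWED READER WITH OFFSET TABLES: per-type kernel certificates against one table pair ⇒ for every letter sequence the path
system read off the window data is a path system on the far ideal-near pairs and the scheme is dominated there by the WORD-INDEPENDENT offset
tables. [g100] -/
theorem thetaReaderNearF_of_types {H₀ R : ℕ} {ℓ : ℤ → ℤ} {lo hi P9max : ℤ} {E : ℕ} {cdOf : List ℤ → List ChordDatum}
    {TRX TNX : ℤ × ℤ × ℤ × ℤ → ℤ} {Adm : List ℤ → Prop} {ϱ α lam mu K η : ℝ} {a b : E3} {w : ℤ → E3} (hℓ : IsLetterSeq ℓ)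
    (hwin : ∀ m : ℤ, Adm (windowWord ℓ (m - H₀) (2 * H₀ + 1))) (hϱ : 0 ≤ ϱ) (hα : 0 < α) (hlam : 0 < lam) (hK0 : 0 ≤ K) (hη : 0 ≤ η)
    (hT : ∀ ω : List ℤ, ω.length = 2 * H₀ + 1 → IsLetterSeq (regW ω) → Adm ω → KernelSlabSoundF H₀ R ω lo hi P9max E (cdOf ω) TRX TNX)
    (hL : IdealLengthCmpF ℓ lam mu a b w) (hA : IdealAngleCmpF ℓ K η a b w) (hP9 : mu ^ 2 * (P9max : ℝ) ≤ 9 * ϱ ^ 2)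
    (hlo : mu ^ 2 * (lo : ℝ) ≤ 9 * ϱ ^ 2) :
    IsPathSystemOn ϱ a b w (IdealNearF ℓ hi) (dataNpF H₀ fun m => cdOf (windowWord ℓ (m - H₀) (2 * H₀ + 1)))
        (dataZF H₀ fun m => cdOf (windowWord ℓ (m - H₀) (2 * H₀ + 1))) ∧
      SchemeDominatedOnP ϱ α a b w (dataNpF H₀ fun m => cdOf (windowWord ℓ (m - H₀) (2 * H₀ + 1)))
        (dataZF H₀ fun m => cdOf (windowWord ℓ (m - H₀) (2 * H₀ + 1))) (IdealNearF ℓ hi)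
        (fun y => (1 + α) * (lam ^ 8)⁻¹ * offsetSumF H₀ R (fun k => (TRX k : ℝ) / 2 ^ E) (y.2 - y.1))
        fun y => (1 + α⁻¹) * (lam ^ 8)⁻¹ * offsetSumF H₀ R (fun k => K * ((TNX k : ℝ) / 2 ^ E) + η * ((TRX k : ℝ) / 2 ^ E)) (y.2 - y.1) := by
  have h := thetaReaderNearF_holds hϱ hα hlam hK0 hη (windowDataF_of_types hℓ hwin hT) hL hA hP9 hlo
  have e₁ : (thetaSumR H₀ R α lam fun _ k => (TRX k : ℝ) / 2 ^ E) =
      fun y => (1 + α) * (lam ^ 8)⁻¹ * offsetSumF H₀ R (fun k => (TRX k : ℝ) / 2 ^ E) (y.2 - y.1) :=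
    funext fun y => thetaSumR_const H₀ R α lam _ y
  have e₂ : (thetaSumN H₀ R α lam K η (fun _ k => (TRX k : ℝ) / 2 ^ E) fun _ k => (TNX k : ℝ) / 2 ^ E) =
      fun y => (1 + α⁻¹) * (lam ^ 8)⁻¹ * offsetSumF H₀ R (fun k => K * ((TNX k : ℝ) / 2 ^ E) + η * ((TRX k : ℝ) / 2 ^ E)) (y.2 - y.1) :=
    funext fun y => thetaSumN_const H₀ R α lam K η _ _ y
  rw [e₁, e₂] at h
  exact h

/-! ### §2 the splice at the ideal cut of a letter sequence and the near ∪ middle cover -/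

/-- spliced piece counts at the ideal cut `hi` of `ℓ`: `np₁` on `IdealNearF ℓ hi`, `np₂` beyond. [g100] -/
def idealSpliceNF (ℓ : ℤ → ℤ) (hi : ℤ) (np₁ np₂ : (Cell 2 × ℤ) × (Cell 2 × ℤ) → ℕ) (x : (Cell 2 × ℤ) × (Cell 2 × ℤ)) : ℕ :=
  if n9F ℓ x ≤ hi then np₁ x else np₂ x

/-- spliced node sequences at the ideal cut `hi` of `ℓ`. [g100] -/
def idealSpliceZF (ℓ : ℤ → ℤ) (hi : ℤ) (z₁ z₂ : (Cell 2 × ℤ) × (Cell 2 × ℤ) → ℕ → Cell 2 × ℤ) (x : (Cell 2 × ℤ) × (Cell 2 × ℤ)) :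
    ℕ → Cell 2 × ℤ :=
  if n9F ℓ x ≤ hi then z₁ x else z₂ x

/-- NEAR ∪ MIDDLE path systems for a letter sequence. [g100] -/
theorem isPathSystemOn_idealCoverF {ϱ : ℝ} {a b : E3} {w : ℤ → E3} {ℓ : ℤ → ℤ} {hi : ℤ}
    {S : (Cell 2 × ℤ) × (Cell 2 × ℤ) → Prop} {np₁ np₂ : (Cell 2 × ℤ) × (Cell 2 × ℤ) → ℕ}
    {z₁ z₂ : (Cell 2 × ℤ) × (Cell 2 × ℤ) → ℕ → Cell 2 × ℤ} (h₁ : IsPathSystemOn ϱ a b w (IdealNearF ℓ hi) np₁ z₁)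
    (h₂ : IsPathSystemOn ϱ a b w (fun x => ¬ IdealNearF ℓ hi x ∧ S x) np₂ z₂) :
    IsPathSystemOn ϱ a b w S (idealSpliceNF ℓ hi np₁ np₂) (idealSpliceZF ℓ hi z₁ z₂) := by
  intro x hx hS
  by_cases hP : n9F ℓ x ≤ hi
  · have hn : idealSpliceNF ℓ hi np₁ np₂ x = np₁ x := if_pos hP
    have hz : idealSpliceZF ℓ hi z₁ z₂ x = z₁ x := if_pos hP
    unfold piece; rw [hn, hz]; exact h₁ x hx hP
  · have hn : idealSpliceNF ℓ hi np₁ np₂ x = np₂ x := if_neg hP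
    have hz : idealSpliceZF ℓ hi z₁ z₂ x = z₂ x := if_neg hP
    unfold piece; rw [hn, hz]; exact h₂ x hx ⟨hP, hS⟩

/-- NEAR ∪ MIDDLE domination for a letter sequence, with the summed tables. [g100] -/
theorem schemeDominatedOnP_idealCoverF {ϱ α : ℝ} {a b : E3} {w : ℤ → E3} {ℓ : ℤ → ℤ} {hi : ℤ}
    {S : (Cell 2 × ℤ) × (Cell 2 × ℤ) → Prop} {np₁ np₂ : (Cell 2 × ℤ) × (Cell 2 × ℤ) → ℕ}
    {z₁ z₂ : (Cell 2 × ℤ) × (Cell 2 × ℤ) → ℕ → Cell 2 × ℤ} {ΘR₁ ΘN₁ ΘR₂ ΘN₂ : (Cell 2 × ℤ) × (Cell 2 × ℤ) → ℝ}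
    (h₁ : SchemeDominatedOnP ϱ α a b w np₁ z₁ (IdealNearF ℓ hi) ΘR₁ ΘN₁)
    (h₂ : SchemeDominatedOnP ϱ α a b w np₂ z₂ (fun x => ¬ IdealNearF ℓ hi x ∧ S x) ΘR₂ ΘN₂) :
    SchemeDominatedOnP ϱ α a b w (idealSpliceNF ℓ hi np₁ np₂) (idealSpliceZF ℓ hi z₁ z₂) S
      (fun y => ΘR₁ y + ΘR₂ y) (fun y => ΘN₁ y + ΘN₂ y) := by
  intro X hX y
  set X₁ := X.filter (fun x => n9F ℓ x ≤ hi) with hX₁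
  set X₂ := X.filter (fun x => ¬ n9F ℓ x ≤ hi) with hX₂
  have hA₁ : ∀ x ∈ X₁, ϱ < ‖bondVec a b w x‖ ∧ IdealNearF ℓ hi x := fun x hx => by
    rw [hX₁, Finset.mem_filter] at hx; exact ⟨(hX x hx.1).1, hx.2⟩
  have hA₂ : ∀ x ∈ X₂, ϱ < ‖bondVec a b w x‖ ∧ (¬ IdealNearF ℓ hi x ∧ S x) := fun x hx => by
    rw [hX₂, Finset.mem_filter] at hx; exact ⟨(hX x hx.1).1, hx.2, (hX x hx.1).2⟩
  have e₁ : ∀ x ∈ X₁, _ := fun x hx =>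
    schemeSums_congr (α := α) (a := a) (b := b) (w := w) (show idealSpliceNF ℓ hi np₁ np₂ x = np₁ x from if_pos (hA₁ x hx).2)
      (show idealSpliceZF ℓ hi z₁ z₂ x = z₁ x from if_pos (hA₁ x hx).2) y
  have e₂ : ∀ x ∈ X₂, _ := fun x hx =>
    schemeSums_congr (α := α) (a := a) (b := b) (w := w) (show idealSpliceNF ℓ hi np₁ np₂ x = np₂ x from if_neg (hA₂ x hx).2.1)
      (show idealSpliceZF ℓ hi z₁ z₂ x = z₂ x from if_neg (hA₂ x hx).2.1) y
  obtain ⟨hR₁, hN₁⟩ := h₁ X₁ hA₁ y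
  obtain ⟨hR₂, hN₂⟩ := h₂ X₂ hA₂ y
  constructor
  · rw [← Finset.sum_filter_add_sum_filter_not X (fun x => n9F ℓ x ≤ hi),
      Finset.sum_congr rfl fun x hx => (e₁ x hx).1, Finset.sum_congr rfl fun x hx => (e₂ x hx).1]
    exact add_le_add hR₁ hR₂
  · rw [← Finset.sum_filter_add_sum_filter_not X (fun x => n9F ℓ x ≤ hi),
      Finset.sum_congr rfl fun x hx => (e₁ x hx).2, Finset.sum_congr rfl fun x hx => (e₂ x hx).2]
    exact add_le_add hN₁ hN₂

/-! ### §3 the registry floor and the middle placement for a letter sequence -/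

/-- THE REGISTRY FLOOR LEMMA for a letter sequence: `xiFloor (x.2 − x.1) ≤ n9F ℓ x ≤ xiCeil (x.2 − x.1)` (ZZZYRCY `xiFloor_le_n9W` ported). [g100] -/
theorem xiFloor_le_n9F {ℓ : ℤ → ℤ} (hℓ : IsLetterSeq ℓ) (x : (Cell 2 × ℤ) × (Cell 2 × ℤ)) :
    ((xiFloor (x.2 - x.1) : ℕ) : ℤ) ≤ n9F ℓ x ∧ n9F ℓ x ≤ ((xiCeil (x.2 - x.1) : ℕ) : ℤ) := by
  have hd : -2 ≤ ℓ x.2.2 - ℓ x.1.2 ∧ ℓ x.2.2 - ℓ x.1.2 ≤ 2 := by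
    obtain ⟨a1, a2⟩ := hℓ x.2.2
    obtain ⟨b1, b2⟩ := hℓ x.1.2
    constructor <;> linarith
  have hX : (x.2 - x.1).1 0 = x.2.1 0 - x.1.1 0 := rfl
  have hY : (x.2 - x.1).1 1 = x.2.1 1 - x.1.1 1 := rfl
  have hM : (x.2 - x.1).2 = x.2.2 - x.1.2 := rfl
  have key : n9F ℓ x = xiQhex (3 * (x.2.1 0 - x.1.1 0) + (ℓ x.2.2 - ℓ x.1.2))
      (3 * (x.2.1 1 - x.1.1 1) + (ℓ x.2.2 - ℓ x.1.2)) + 6 * ((x.2.2 - x.1.2) * (x.2.2 - x.1.2)) := by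
    simp only [n9F, refF0, refF1, xiQhex]; ring
  by_cases hm : x.2.2 - x.1.2 = 0
  · have h12 : x.2.2 = x.1.2 := sub_eq_zero.mp hm
    have hq : n9F ℓ x = ((xiQ0 (x.2.1 0 - x.1.1 0) (x.2.1 1 - x.1.1 1) : ℕ) : ℤ) := by
      rw [key, xiQ0, Int.toNat_of_nonneg (xiQhex_nonneg _ _), hm, h12, sub_self, add_zero, add_zero, mul_zero, mul_zero, add_zero]
    have hF : xiFloor (x.2 - x.1) = xiQ0 (x.2.1 0 - x.1.1 0) (x.2.1 1 - x.1.1 1) := by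
      simp only [xiFloor, hM, hm, hX, hY, if_true]
    have hC : xiCeil (x.2 - x.1) = xiQ0 (x.2.1 0 - x.1.1 0) (x.2.1 1 - x.1.1 1) := by
      simp only [xiCeil, hM, hm, hX, hY, if_true]
    rw [hF, hC, ← hq]; exact ⟨le_rfl, le_rfl⟩
  · have hF : xiFloor (x.2 - x.1) =
        xiQmn (x.2.1 0 - x.1.1 0) (x.2.1 1 - x.1.1 1) + 6 * (x.2.2 - x.1.2).natAbs * (x.2.2 - x.1.2).natAbs := by
      simp only [xiFloor, hM, hm, hX, hY, if_false]
    have hC : xiCeil (x.2 - x.1) =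
        xiQmx (x.2.1 0 - x.1.1 0) (x.2.1 1 - x.1.1 1) + 6 * (x.2.2 - x.1.2).natAbs * (x.2.2 - x.1.2).natAbs := by
      simp only [xiCeil, hM, hm, hX, hY, if_false]
    have hsq : ((x.2.2 - x.1.2).natAbs : ℤ) * ((x.2.2 - x.1.2).natAbs : ℤ) = (x.2.2 - x.1.2) * (x.2.2 - x.1.2) :=
      Int.natAbs_mul_self' _
    obtain ⟨h1, h2⟩ := xiQmn_le_offset hd (x.2.1 0 - x.1.1 0) (x.2.1 1 - x.1.1 1)
    rw [hF, hC, key]; push_cast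
    constructor <;> nlinarith [h1, h2, hsq, abs_mul_abs_self (x.2.2 - x.1.2)]

/-- a pair of positive ideal length has a nonzero index difference (letter sequence). [g100] -/
theorem sub_ne_zero_of_n9F_pos {ℓ : ℤ → ℤ} {x : (Cell 2 × ℤ) × (Cell 2 × ℤ)} (h : 0 < n9F ℓ x) : x.2 - x.1 ≠ 0 := by
  intro h0
  have h12 : x.2 = x.1 := sub_eq_zero.mp h0
  have hz : n9F ℓ x = 0 := by simp only [n9F, h12, sub_self, mul_zero, add_zero, zero_pow two_ne_zero]
  rw [hz] at h; exact lt_irrefl _ h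

/-- ★ THE MIDDLE PLACEMENT for a letter sequence: the length comparison, `(HI1 : ℤ) ≤ hi` and `9·D² ≤ λ²·HI2` place every far pair of the
middle class `¬ IdealNearF ℓ hi x ∧ ‖e_x‖ ≤ D` in the certified vector set — the `hgeo` of `schemeDominatedOnP_middle` (ZZZYRCVP). [g100] -/
theorem middle_hgeoF {ℓ : ℤ → ℤ} (hℓ : IsLetterSeq ℓ) {hi : ℤ} {HI1 HI2 : ℕ} {ϱ lam mu D : ℝ} {a b : E3} {w : ℤ → E3}
    (hlam : 0 < lam) (hL : IdealLengthCmpF ℓ lam mu a b w) (h1 : (HI1 : ℤ) ≤ hi) (h2 : 9 * D ^ 2 ≤ lam ^ 2 * (HI2 : ℝ)) :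
    ∀ x : (Cell 2 × ℤ) × (Cell 2 × ℤ), ϱ < ‖bondVec a b w x‖ → (¬ IdealNearF ℓ hi x ∧ ‖bondVec a b w x‖ ≤ D) →
      xiMember HI1 HI2 (x.2 - x.1) ∧ lam ^ 2 * (xiFloor (x.2 - x.1) : ℝ) ≤ 9 * ‖bondVec a b w x‖ ^ 2 := by
  intro x _ hP
  obtain ⟨hN, hD⟩ := hP
  have hN' : hi < n9F ℓ x := not_le.mp hN
  obtain ⟨hfl, hce⟩ := xiFloor_le_n9F hℓ x
  have hpos : 0 < n9F ℓ x := lt_of_le_of_lt (by positivity) (h1.trans_lt hN')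
  have hc : HI1 < xiCeil (x.2 - x.1) := by exact_mod_cast h1.trans_lt (hN'.trans_le hce)
  have hflR : ((xiFloor (x.2 - x.1) : ℕ) : ℝ) ≤ (n9F ℓ x : ℝ) := by exact_mod_cast hfl
  have hle : lam ^ 2 * (xiFloor (x.2 - x.1) : ℝ) ≤ 9 * ‖bondVec a b w x‖ ^ 2 :=
    (mul_le_mul_of_nonneg_left hflR (sq_nonneg lam)).trans (hL x).1
  have hD2 : ‖bondVec a b w x‖ ^ 2 ≤ D ^ 2 := pow_le_pow_left₀ (norm_nonneg _) hD 2
  have hf2R : (xiFloor (x.2 - x.1) : ℝ) ≤ (HI2 : ℝ) := le_of_mul_le_mul_left (by linarith) (pow_pos hlam 2)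
  have hf2 : xiFloor (x.2 - x.1) ≤ HI2 := by exact_mod_cast hf2R
  exact ⟨⟨hc, hf2, sub_ne_zero_of_n9F_pos hpos⟩, hle⟩

/-! ### §4 the three-way box reader along a letter assignment -/

/-- ★★ **THE THREE-WAY BOX READER FOR LETTER-FUNCTION BOXES**: on a box `B` with letter assignment `ℓf` and near cut `hi`, the NEAR reader
per admissible word on `IdealNearF (ℓf L w') hi` (§1 / ZZZYRCZW), the MIDDLE king-table domination on `¬ IdealNearF (ℓf L w') hi ∧ ‖e‖ ≤ D`,
the box fact `‖gen₁ L‖ + ‖gen₂ L‖ + ℓ₀ ≤ ϱ` and the far-far numeric inequality give `BoxSchemeP` for the twice-spliced system. [g100] -/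
theorem boxSchemeP_of_cover3F {s Λ c₀ ℓ₀ ϱ α D θ : ℝ} (hα : 0 < α) (hc : 0 < c₀) (hϱ0 : 0 < ϱ) (hD : 0 < D) {nD n₁ : ℕ}
    (hnD : (nD : ℝ) - 1 ≤ D / ϱ) (h2 : 2 ≤ n₁) (hnD₁ : nD ≤ n₁)
    (hθ : ∑ n ∈ Finset.Ico nD n₁, (2 * (n : ℝ) * (n + 1) * (2 * n + 1) / 3) * (7 * (n : ℝ) / D ^ 8) +
        14 * ((n₁ : ℝ) + 1) * (2 * n₁ + 1) / (9 * c₀ ^ 8 * (n₁ : ℝ) ^ 2 * ((n₁ : ℝ) - 1) ^ 3) ≤ θ)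
    (ℓf : (E3 ≃L[ℝ] E3) → (ℤ → E3) → ℤ → ℤ) (hi : ℤ) {B : (E3 ≃L[ℝ] E3) → (ℤ → E3) → Prop}
    {np₁ : (E3 ≃L[ℝ] E3) → (ℤ → E3) → (Cell 2 × ℤ) × (Cell 2 × ℤ) → ℕ}
    {z₁ : (E3 ≃L[ℝ] E3) → (ℤ → E3) → (Cell 2 × ℤ) × (Cell 2 × ℤ) → ℕ → Cell 2 × ℤ}
    {ΘR₁ ΘN₁ ΘR₂ ΘN₂ : (E3 ≃L[ℝ] E3) → (ℤ → E3) → (Cell 2 × ℤ) × (Cell 2 × ℤ) → ℝ}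
    (hgen : ∀ (L : E3 ≃L[ℝ] E3) (w' : ℤ → E3), B L w' → ‖gen₁ L‖ + ‖gen₂ L‖ + ℓ₀ ≤ ϱ)
    (hnear : ∀ a : ℝ, 0 < a → ∀ (L : E3 ≃L[ℝ] E3) (w' : ℤ → E3), IsAdmissibleWord a s Λ c₀ ℓ₀ L w' → B L w' →
      IsPathSystemOn ϱ (gen₁ L) (gen₂ L) w' (IdealNearF (ℓf L w') hi) (np₁ L w') (z₁ L w') ∧
        SchemeDominatedOnP ϱ α (gen₁ L) (gen₂ L) w' (np₁ L w') (z₁ L w') (IdealNearF (ℓf L w') hi) (ΘR₁ L w') (ΘN₁ L w'))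
    (hmid : ∀ a : ℝ, 0 < a → ∀ (L : E3 ≃L[ℝ] E3) (w' : ℤ → E3), IsAdmissibleWord a s Λ c₀ ℓ₀ L w' → B L w' →
      SchemeDominatedOnP ϱ α (gen₁ L) (gen₂ L) w' kingN kingZ
        (fun x => ¬ IdealNearF (ℓf L w') hi x ∧ ‖bondVec (gen₁ L) (gen₂ L) w' x‖ ≤ D) (ΘR₂ L w') (ΘN₂ L w')) :
    BoxSchemeP s Λ c₀ ℓ₀ ϱ α B
      (fun L w' => pathSpliceN D (gen₁ L) (gen₂ L) w' (idealSpliceNF (ℓf L w') hi (np₁ L w') kingN) kingN)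
      (fun L w' => pathSpliceZ D (gen₁ L) (gen₂ L) w' (idealSpliceZF (ℓf L w') hi (z₁ L w') kingZ) kingZ)
      (fun L w' y => ΘR₁ L w' y + ΘR₂ L w' y + (1 + α) * θ) (fun L w' y => ΘN₁ L w' y + ΘN₂ L w' y + (1 + α⁻¹) * θ) := by
  refine boxSchemeP_of_split hα hc hϱ0 hD hnD h2 hnD₁ hθ hgen fun a ha L w' hA hB => ?_
  obtain ⟨hP₁, hS₁⟩ := hnear a ha L w' hA hB
  have hw : IsLayeredCrystal c₀ (gen₁ L) (gen₂ L) w' := hA.2.2.2.1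
  have hlip : ∀ m : ℤ, ‖w' (m + 1) - w' m‖ ≤ ℓ₀ := hA.2.2.2.2.1
  have hK := isPathSystemOn_of (isPathSystem_king hc hw hlip (hgen L w' hB))
    (fun x => ¬ IdealNearF (ℓf L w') hi x ∧ ‖bondVec (gen₁ L) (gen₂ L) w' x‖ ≤ D)
  exact ⟨isPathSystemOn_idealCoverF hP₁ hK, schemeDominatedOnP_idealCoverF hS₁ (hmid a ha L w' hA hB)⟩

/-! ### §5 the canonical letter assignment of a shape cell -/

/-- choice-free existence behind the assignment: some `ℓ` that registers `(L, w')` whenever the word lies in the cell. [g100] -/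
theorem exists_letterOfW (s aLo aHi τ hLo hHi : ℝ) (L : E3 ≃L[ℝ] E3) (w' : ℤ → E3) :
    ∃ ℓ : ℤ → ℤ, InBoxW s aLo aHi τ hLo hHi L w' → IsLetterSeq ℓ ∧ SlabBoxF ℓ aLo aHi s τ hLo hHi L w' := by
  by_cases h : InBoxW s aLo aHi τ hLo hHi L w'
  · obtain ⟨ℓ, hℓ, hB⟩ := h
    exact ⟨ℓ, fun _ => ⟨hℓ, hB⟩⟩
  · exact ⟨fun _ => 0, fun h' => absurd h' h⟩

/-- ★ THE LETTER ASSIGNMENT of the shape cell `(s, aLo, aHi, τ, hLo, hHi)`: a registering letter sequence of each word of the cell (junk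
outside the cell) — the `ℓf` of `boxSchemeP_of_cover3F`. [g100] -/
noncomputable def letterOfW (s aLo aHi τ hLo hHi : ℝ) (L : E3 ≃L[ℝ] E3) (w' : ℤ → E3) : ℤ → ℤ :=
  Classical.choose (exists_letterOfW s aLo aHi τ hLo hHi L w')

/-- its specification on the cell: letters in `{0,1,2}` and the slab box — the inputs of `idealLengthCmpF_of_slabBoxF` (ZZZYRCZO),
`idealAngleCmpF_of_slabBoxF` (ZZZYRCZP) and of §1's `thetaReaderNearF_of_types`. [g100] -/
theorem letterOfW_spec {s aLo aHi τ hLo hHi : ℝ} {L : E3 ≃L[ℝ] E3} {w' : ℤ → E3} (h : InBoxW s aLo aHi τ hLo hHi L w') :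
    IsLetterSeq (letterOfW s aLo aHi τ hLo hHi L w') ∧ SlabBoxF (letterOfW s aLo aHi τ hLo hHi L w') aLo aHi s τ hLo hHi L w' :=
  Classical.choose_spec (exists_letterOfW s aLo aHi τ hLo hHi L w') h

/-- choice-free existence behind the hollow assignment. [g100] -/
theorem exists_letterOfWH (s aLo aHi τ hLo hHi : ℝ) (L : E3 ≃L[ℝ] E3) (w' : ℤ → E3) :
    ∃ ℓ : ℤ → ℤ, InBoxWH s aLo aHi τ hLo hHi L w' → IsLetterSeq ℓ ∧ IsHollowSeq ℓ ∧ SlabBoxF ℓ aLo aHi s τ hLo hHi L w' := by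
  by_cases h : InBoxWH s aLo aHi τ hLo hHi L w'
  · obtain ⟨ℓ, hℓ, hH, hB⟩ := h
    exact ⟨ℓ, fun _ => ⟨hℓ, hH, hB⟩⟩
  · exact ⟨fun _ => 0, fun h' => absurd h' h⟩

/-- ★ THE LETTER ASSIGNMENT of the HOLLOW shape cell (ZZZYRCZX `InBoxWH`): the `ℓf` of record of `boxSchemeP_of_cover3F`. [g100] -/
noncomputable def letterOfWH (s aLo aHi τ hLo hHi : ℝ) (L : E3 ≃L[ℝ] E3) (w' : ℤ → E3) : ℤ → ℤ :=
  Classical.choose (exists_letterOfWH s aLo aHi τ hLo hHi L w')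

/-- its specification on the cell: letters, hollowness (so `isHollowWindow_windowWord` admits its windows in §1) and the slab box. [g100] -/
theorem letterOfWH_spec {s aLo aHi τ hLo hHi : ℝ} {L : E3 ≃L[ℝ] E3} {w' : ℤ → E3} (h : InBoxWH s aLo aHi τ hLo hHi L w') :
    IsLetterSeq (letterOfWH s aLo aHi τ hLo hHi L w') ∧ IsHollowSeq (letterOfWH s aLo aHi τ hLo hHi L w') ∧
      SlabBoxF (letterOfWH s aLo aHi τ hLo hHi L w') aLo aHi s τ hLo hHi L w' :=
  Classical.choose_spec (exists_letterOfWH s aLo aHi τ hLo hHi L w') h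

end Summit.AtomisticToContinuum.Crystallization.Theorems.ChartedZeroExcessLayeredLatticeLiouville
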